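import Literature.NumberTheory.EllipticCurves.KubertTateFiveGaussianTwistRankZero
import Literature.NumberTheory.NumberFields.CyclotomicFieldFourValuations
import Mathlib.NumberTheory.SumTwoSquares
import Mathlib.Tactic.NormNum.Prime
import HarnessLib

/-!
# CLASS-WIDE: `rank E_{m,n}^{(-4)}(ℚ) ≤ ω₁(mn)` — the rank of the quadratic twist by `-1` of a Gaussian-tame
# Kubert–Tate `5`-torsion curve with full `ℚ`-box is at most the number of primes `≡ 1 (mod 4)` dividing `mn`

PROOF-ONLY file (theorems only, no definition, no named fact, no `sorry`), topic `NumberTheory/EllipticCurves`; the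
sequel of the tree's `KubertTateFiveGaussianTwistRankZero` (the case `ω₁(mn) = 0`: twist rank `0`).  Setting:
`E = E_{m,n} = [n−m, −mn, −mn², 0, 0]` over `ℚ`, Gaussian tame (`5 ∤ Δ`; bad `ℓ ≢ 1 (5)`, `ℓ ≡ 4 (5) ⇒ ℓ ≡ 1 (4)`),
`K = ℚ(i)` (any `K` with `IsCyclotomicExtension {4} ℚ K`), `ω(mn) = #{ℓ ∣ mn}`, `ω₁(mn) = #{ℓ ∣ mn : ℓ ≡ 1 (mod 4)}`.

* `exists_support_split` — **a supporting set of places of `ℚ(i)` with `#S ≤ ω(mn) + ω₁(mn)`**: one place above `2` and above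
  each `ℓ ≡ 3 (4)`, the two places `(a ± bζ₄)` above each `ℓ = a² + b² ≡ 1 (4)` (Fermat, Mathlib `Nat.Prime.sq_add_sq`; tree
  `CyclotomicFieldFourValuations.mem_or_mem_of_sq_add_sq_eq`), and every place containing `m` or `n` is one of them.
* **`mordellWeilRank_baseChange_succ_le`** — `rank E_{m,n}(ℚ(i)) + 1 ≤ ω(mn) + ω₁(mn)` class-wide (the `μ₅`-box over `ℚ(i)`,
  tree `KubertTateMuDescentNF.mordellWeilRank_succ_le`, at this `S`; reference point a rational `(x, y)` with `x ∉ {0, mn}` and a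
  good prime `q ≤ 11`).
* **`mordellWeilRank_twist_le`** — `rank E_{m,n}^{(-4)}(ℚ) ≤ ω(mn) + ω₁(mn) − 1 − rank E_{m,n}(ℚ)`; hence, when the `ℚ`-box is full
  (`ω(mn) ≤ rank E(ℚ) + 1`), **`mordellWeilRank_twist_le_card_split : rank E_{m,n}^{(-4)}(ℚ) ≤ ω₁(mn)`**.

The bound is ATTAINED in the tree: `(146, 13)` (`ω₁ = 2`, twist rank `2`, `KubertTate14613GaussianDescent`) and `(13, 3)`
(`ω₁ = 1`, twist rank `1`, `KubertTate133GaussianDescent`) — there the box over `ℚ(i)` is full and `t₅` of the twist vanishes.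
Transfer statement T (stmt-22356) instrument; BSD is not proved by this.

## References

* [SilvermanAEC2009] J. H. Silverman, *AEC*, 2nd ed., Thm. X.4.2, Prop. X.4.9, Exercise 10.16.
* [Fisher2001FiveSevenDescent] T. Fisher, JEMS 3 (2001), §§1–2.
* [IrelandRosen1982] K. Ireland, M. Rosen, *A Classical Introduction to Modern Number Theory*, Ch. 9 §7 Lemmas 3–5; Ch. 8
  (Fermat's two-square theorem).
-/

noncomputable section

open scoped Classical NNReal NumberField AddSubgroup
open WeierstrassCurve WeierstrassCurve.Isogeny Field IsDedekindDomain Ideal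
open Literature.NumberTheory.EllipticCurves Literature.NumberTheory.EllipticCurves.KubertTateVelu
  Literature.NumberTheory.EllipticCurves.KubertTateMuDescentNF Literature.NumberTheory.NumberFields
  Literature.NumberTheory.EllipticCurves.KubertTate16883GaussianDescent

namespace Literature.NumberTheory.EllipticCurves

namespace KubertTateGaussianTwist

variable {K : Type} [Field K] [NumberField K] [IsCyclotomicExtension {4} ℚ K]
variable (m n : ℤ) [hEQ : (kubertTateFive (m : ℚ) (n : ℚ)).IsElliptic]

/-! ## §1 At most two places of `ℚ(i)` above each rational prime; two only above `ℓ ≡ 1 (mod 4)` -/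

omit [IsCyclotomicExtension {4} ℚ K] in
/-- Every rational prime lies under some finite place. [cite: IrelandRosen1982, Ch. 9 §7] -/
private theorem exists_natCast_mem_asIdeal' {ℓ : ℕ} (hℓ : ℓ.Prime) :
    ∃ v : HeightOneSpectrum (𝓞 K), (ℓ : 𝓞 K) ∈ v.asIdeal := by
  haveI := Fact.mk hℓ
  obtain ⟨⟨P, hP, hPover⟩⟩ := (span {(ℓ : ℤ)}).nonempty_primesOver (S := 𝓞 K)
  have hℓZ : (ℓ : ℤ) ≠ 0 := Int.natCast_ne_zero.mpr hℓ.ne_zero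
  have hP0 : P ≠ ⊥ := Ideal.ne_bot_of_liesOver_of_ne_bot (p := span {(ℓ : ℤ)}) (by simpa using hℓZ) P
  refine ⟨⟨P, hP, hP0⟩, ?_⟩
  have h : ((ℓ : ℤ) : ℤ) ∈ span {(ℓ : ℤ)} := mem_span_singleton_self _
  rw [mem_of_liesOver P] at h
  simpa using h

/-- **The places above a rational prime `ℓ` in `ℚ(i)`**: there are places `v₁ ∋ ℓ`, `v₂ ∋ ℓ` such that every place containing `ℓ`
is `v₁` or `v₂`, and `v₁ = v₂` unless `ℓ ≡ 1 (mod 4)` (`2` ramifies, `ℓ ≡ 3 (4)` is inert, `ℓ ≡ 1 (4)` splits as `(a+bζ)(a−bζ)` with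
`ℓ = a² + b²`). [cite: IrelandRosen1982, Ch. 9 §7 Lemmas 3–5] -/
theorem exists_two_places {ℓ : ℕ} (hℓ : ℓ.Prime) :
    ∃ v₁ v₂ : HeightOneSpectrum (𝓞 K), (ℓ : 𝓞 K) ∈ v₁.asIdeal ∧ (ℓ : 𝓞 K) ∈ v₂.asIdeal ∧
      (∀ v : HeightOneSpectrum (𝓞 K), (ℓ : 𝓞 K) ∈ v.asIdeal → v = v₁ ∨ v = v₂) ∧ (ℓ % 4 ≠ 1 → v₁ = v₂) := by
  haveI := Fact.mk hℓ
  by_cases h1 : ℓ % 4 = 1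
  · -- split: `ℓ = a² + b²`
    obtain ⟨a, b, hab⟩ := Nat.Prime.sq_add_sq (p := ℓ) (by omega)
    have hζ := (IsCyclotomicExtension.zeta_spec 4 ℚ K).toInteger_isPrimitiveRoot
    set ζ : 𝓞 K := (IsCyclotomicExtension.zeta_spec 4 ℚ K).toInteger
    have habZ : (a : ℤ) ^ 2 + (b : ℤ) ^ 2 = ℓ := by exact_mod_cast hab
    have habZ' : (a : ℤ) ^ 2 + (-(b : ℤ)) ^ 2 = ℓ := by rw [neg_sq]; exact habZ
    have p₁ := prime_int_add_int_mul_four hζ hℓ habZ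
    have p₂ := prime_int_add_int_mul_four hζ hℓ habZ'
    obtain ⟨v₁, hv₁⟩ := exists_asIdeal_eq_span p₁
    obtain ⟨v₂, hv₂⟩ := exists_asIdeal_eq_span p₂
    have hπ₁ : ((a : ℤ) : 𝓞 K) + ((b : ℤ) : 𝓞 K) * ζ ∈ v₁.asIdeal := by rw [hv₁]; exact mem_span_singleton_self _
    have hπ₂ : ((a : ℤ) : 𝓞 K) + ((-(b : ℤ) : ℤ) : 𝓞 K) * ζ ∈ v₂.asIdeal := by rw [hv₂]; exact mem_span_singleton_self _
    have hsq : ζ ^ 2 + 1 = 0 := by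
      rw [(hζ.pow (by norm_num) (show 4 = 2 * 2 by norm_num)).eq_neg_one_of_two_right, neg_add_cancel]
    have e : (ℓ : 𝓞 K) = (((a : ℤ) : 𝓞 K) + ((b : ℤ) : 𝓞 K) * ζ) * (((a : ℤ) : 𝓞 K) + ((-(b : ℤ) : ℤ) : 𝓞 K) * ζ) := by
      have : ((ℓ : ℤ) : 𝓞 K) = (ℓ : 𝓞 K) := by push_cast; rfl
      rw [← this, ← habZ]; push_cast
      linear_combination ((b : 𝓞 K) ^ 2) * hsq
    have hℓ₁ : (ℓ : 𝓞 K) ∈ v₁.asIdeal := by rw [e]; exact v₁.asIdeal.mul_mem_right _ hπ₁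
    have hℓ₂ : (ℓ : 𝓞 K) ∈ v₂.asIdeal := by rw [e]; exact v₂.asIdeal.mul_mem_left _ hπ₂
    refine ⟨v₁, v₂, hℓ₁, hℓ₂, fun v hv ↦ ?_, fun h ↦ absurd h1 h⟩
    rcases mem_or_mem_of_sq_add_sq_eq hζ habZ hv with h | h
    · exact Or.inl (eq_of_mem_of_mem_of_prime p₁ h hπ₁)
    · refine Or.inr (eq_of_mem_of_mem_of_prime p₂ ?_ hπ₂)
      have e' : ((a : ℤ) : 𝓞 K) + ((-(b : ℤ) : ℤ) : 𝓞 K) * ζ = ((a : ℤ) : 𝓞 K) - ((b : ℤ) : 𝓞 K) * ζ := by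
        push_cast; ring
      rw [e']; exact h
  · -- `ℓ = 2` or `ℓ ≡ 3 (mod 4)`: a unique place
    obtain ⟨v, hv⟩ := exists_natCast_mem_asIdeal' (K := K) hℓ
    refine ⟨v, v, hv, hv, fun w hw ↦ Or.inl ?_, fun _ ↦ rfl⟩
    rcases hℓ.eq_two_or_odd' with rfl | hodd
    · exact eq_of_two_mem (by exact_mod_cast hw) (by exact_mod_cast hv)
    · have h3 : ℓ % 4 = 3 := by
        rcases hodd with ⟨k, hk⟩
        omega
      exact eq_of_natCast_mem_of_mod_four_eq_three hℓ h3 hw hv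

omit [NumberField K] [IsCyclotomicExtension {4} ℚ K] in
/-- A finite place containing a rational prime `ℓ` and an integer `z` has `ℓ ∣ z`. [folklore] -/
private theorem natPrime_dvd_of_mem' (v : HeightOneSpectrum (𝓞 K)) {ℓ : ℕ} (hℓ : ℓ.Prime)
    (hℓv : (ℓ : 𝓞 K) ∈ v.asIdeal) {z : ℤ} (hzv : ((z : ℤ) : 𝓞 K) ∈ v.asIdeal) : (ℓ : ℤ) ∣ z :=
  natCast_dvd_of_intCast_mem hℓ hℓv hzv

omit hEQ in
/-- **A supporting set of places of `ℚ(i)` with `#S ≤ ω(mn) + ω₁(mn)`**, where `ω₁(mn)` counts the prime factors `≡ 1 (mod 4)`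
(split in `ℤ[i]`): every place containing `m` or `n` lies in `S`. [cite: IrelandRosen1982, Ch. 9 §7 Lemmas 3–5] -/
theorem exists_support_split (hm : m ≠ 0) (hn : n ≠ 0) :
    ∃ S : Finset (HeightOneSpectrum (𝓞 K)),
      S.card ≤ (m * n).natAbs.primeFactors.card + ((m * n).natAbs.primeFactors.filter (fun ℓ ↦ ℓ % 4 = 1)).card ∧
      ∀ v : HeightOneSpectrum (𝓞 K), v ∉ S → ((m : ℤ) : 𝓞 K) ∉ v.asIdeal ∧ ((n : ℤ) : 𝓞 K) ∉ v.asIdeal := by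
  have hch : ∀ ℓ : (m * n).natAbs.primeFactors, ∃ v₁ v₂ : HeightOneSpectrum (𝓞 K),
      ((ℓ : ℕ) : 𝓞 K) ∈ v₁.asIdeal ∧ ((ℓ : ℕ) : 𝓞 K) ∈ v₂.asIdeal ∧
      (∀ v : HeightOneSpectrum (𝓞 K), ((ℓ : ℕ) : 𝓞 K) ∈ v.asIdeal → v = v₁ ∨ v = v₂) ∧ ((ℓ : ℕ) % 4 ≠ 1 → v₁ = v₂) :=
    fun ℓ ↦ exists_two_places (K := K) (Nat.prime_of_mem_primeFactors ℓ.2)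
  choose pl₁ pl₂ hpl₁ hpl₂ hcover hsame using hch
  set F : Finset ↥(m * n).natAbs.primeFactors :=
    Finset.univ.filter (fun ℓ : ↥(m * n).natAbs.primeFactors ↦ (ℓ : ℕ) % 4 = 1) with hF
  refine ⟨Finset.univ.image pl₁ ∪ F.image pl₂, ?_, fun v hv ↦ ?_⟩
  · have hFcard : F.card ≤ ((m * n).natAbs.primeFactors.filter (fun ℓ ↦ ℓ % 4 = 1)).card := by
      rw [← Finset.card_map (Function.Embedding.subtype (· ∈ (m * n).natAbs.primeFactors))]
      apply Finset.card_le_card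
      intro ℓ hℓ
      rw [Finset.mem_map] at hℓ
      obtain ⟨x, hx, rfl⟩ := hℓ
      rw [hF, Finset.mem_filter] at hx
      exact Finset.mem_filter.mpr ⟨x.2, hx.2⟩
    calc (Finset.univ.image pl₁ ∪ F.image pl₂).card
        ≤ (Finset.univ.image pl₁).card + (F.image pl₂).card := Finset.card_union_le _ _
      _ ≤ (Finset.univ : Finset ↥(m * n).natAbs.primeFactors).card + F.card :=
          Nat.add_le_add Finset.card_image_le Finset.card_image_le
      _ ≤ _ := by rw [Finset.card_univ, Fintype.card_coe]; exact Nat.add_le_add_left hFcard _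
  · have hmn0 : (m * n).natAbs ≠ 0 := Int.natAbs_ne_zero.mpr (mul_ne_zero hm hn)
    have key : ∀ z : ℤ, z ∣ m * n → ((z : ℤ) : 𝓞 K) ∈ v.asIdeal → False := by
      intro z hz hzv
      obtain ⟨ℓ, hℓ, hℓv⟩ := KubertTateVelu.exists_nat_prime_mem_asIdeal v
      have hℓz : (ℓ : ℤ) ∣ z := natPrime_dvd_of_mem' v hℓ hℓv hzv
      have hℓmn : ℓ ∈ (m * n).natAbs.primeFactors := by
        rw [Nat.mem_primeFactors]
        exact ⟨hℓ, Int.natCast_dvd.mp (hℓz.trans hz), hmn0⟩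
      rcases hcover ⟨ℓ, hℓmn⟩ v hℓv with h | h
      · exact hv (Finset.mem_union_left _ (Finset.mem_image.mpr ⟨⟨ℓ, hℓmn⟩, Finset.mem_univ _, h.symm⟩))
      · by_cases h1 : ℓ % 4 = 1
        · exact hv (Finset.mem_union_right _ (Finset.mem_image.mpr
            ⟨⟨ℓ, hℓmn⟩, Finset.mem_filter.mpr ⟨Finset.mem_univ _, h1⟩, h.symm⟩))
        · have e := hsame ⟨ℓ, hℓmn⟩ h1
          exact hv (Finset.mem_union_left _ (Finset.mem_image.mpr ⟨⟨ℓ, hℓmn⟩, Finset.mem_univ _, by rw [e, h]⟩))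
    exact ⟨fun h ↦ key m (dvd_mul_right m n) h, fun h ↦ key n (dvd_mul_left n m) h⟩

/-! ## §2 The rank bounds -/

section Main

variable (h5 : ¬ (5 : ℤ) ∣ (kubertTateFive m n).Δ)
  (hbad : ∀ ℓ : ℕ, ℓ.Prime → (ℓ : ℤ) ∣ (kubertTateFive m n).Δ → ℓ % 5 ≠ 1 ∧ (ℓ % 5 = 4 → ℓ % 4 = 1))
  {x y : ℚ} (hxy : (kubertTateFive (m : ℚ) (n : ℚ)).toAffine.Nonsingular x y) (hx0 : x ≠ 0) (hx : x ≠ m * n)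
  (q : ℕ) [Fact q.Prime] (hq5 : q ≠ 5) (hq11 : 2 * q + 1 < 25) (hqΔ : ¬ (q : ℤ) ∣ (kubertTateFive m n).Δ)

include h5 hbad hxy hx0 hx hq5 hq11 hqΔ in
/-- **`rank E_{m,n}(ℚ(i)) + 1 ≤ ω(mn) + ω₁(mn)` class-wide** in the Gaussian tame régime (the `μ₅`-box over `ℚ(i)` at the supporting
set of `exists_support_split`; reference point the rational `(x, y)`, `x ∉ {0, mn}`, good prime `q ≤ 11`).
[cite: SilvermanAEC2009, Thm. X.4.2 and Prop. X.4.9] [cite: Fisher2001FiveSevenDescent, §2] -/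
theorem mordellWeilRank_baseChange_succ_le :
    haveI := isElliptic_base (K := K) m n
    (kubertTateFive (m : K) (n : K)).mordellWeilRank + 1 ≤
      (m * n).natAbs.primeFactors.card + ((m * n).natAbs.primeFactors.filter (fun ℓ ↦ ℓ % 4 = 1)).card := by
  haveI := isElliptic_base (K := K) m n
  obtain ⟨hm0, hn0, -⟩ := ne_zero_of_isElliptic (m : ℚ) (n : ℚ)
  have hm : m ≠ 0 := by exact_mod_cast hm0
  have hn : n ≠ 0 := by exact_mod_cast hn0
  obtain ⟨S, hScard, hS⟩ := exists_support_split (K := K) m n hm hn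
  obtain ⟨ψ, hψ⟩ := KubertTateMuDescentNF.exists_dual (K := K) m n
  have hle := KubertTateMuDescentNF.mordellWeilRank_succ_le m n ψ hψ _ (fun σ ↦ smul_toGeomPoints _ σ _)
    (twentyfive_zsmul_toGeomPoints_cast_ne_zero m n hxy hx0 hx q hq5 hq11 hqΔ) S hS h5 hbad
  exact hle.trans hScard

include h5 hbad hxy hx0 hx hq5 hq11 hqΔ in
/-- **`rank E_{m,n}^{(-4)}(ℚ) + rank E_{m,n}(ℚ) + 1 ≤ ω(mn) + ω₁(mn)`** (the twist by `d_{ℚ(i)} = -4`, `≅` the twist by `-1`;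
`rank E(ℚ(i)) = rank E(ℚ) + rank E^{(-4)}(ℚ)`). [cite: SilvermanAEC2009, Thm. X.4.2 and Exercise 10.16] -/
theorem mordellWeilRank_twist_le [((kubertTateFive (m : ℚ) (n : ℚ)).quadraticTwist (-4)).IsElliptic] :
    ((kubertTateFive (m : ℚ) (n : ℚ)).quadraticTwist (-4)).mordellWeilRank + (kubertTateFive (m : ℚ) (n : ℚ)).mordellWeilRank + 1 ≤
      (m * n).natAbs.primeFactors.card + ((m * n).natAbs.primeFactors.filter (fun ℓ ↦ ℓ % 4 = 1)).card := by
  haveI : IsCyclotomicExtension {4} ℚ (CyclotomicField 4 ℚ) := CyclotomicField.isCyclotomicExtension 4 ℚ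
  have h := mordellWeilRank_baseChange_succ_le (K := CyclotomicField 4 ℚ) m n h5 hbad hxy hx0 hx q hq5 hq11 hqΔ
  have hR := mordellWeilRank_base_eq_add (K := CyclotomicField 4 ℚ) m n
  omega

include h5 hbad hxy hx0 hx hq5 hq11 hqΔ in
/-- **`rank E_{m,n}^{(-4)}(ℚ) ≤ ω₁(mn)` when the `ℚ`-box is full** (`ω(mn) ≤ rank E_{m,n}(ℚ) + 1`): the rank of the twist by `-1` of a
Gaussian-tame Kubert–Tate `5`-torsion curve with full `ℚ`-box is at most the number of primes `≡ 1 (mod 4)` dividing `mn` — the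
case `ω₁ = 0` is the tree's `mordellWeilRank_twist_eq_zero`; the bound is attained at `(146, 13)` (`2`) and `(13, 3)` (`1`).
[cite: SilvermanAEC2009, Thm. X.4.2 and Exercise 10.16] [cite: Fisher2001FiveSevenDescent, §2] -/
theorem mordellWeilRank_twist_le_card_split [((kubertTateFive (m : ℚ) (n : ℚ)).quadraticTwist (-4)).IsElliptic]
    (hr : (m * n).natAbs.primeFactors.card ≤ (kubertTateFive (m : ℚ) (n : ℚ)).mordellWeilRank + 1) :
    ((kubertTateFive (m : ℚ) (n : ℚ)).quadraticTwist (-4)).mordellWeilRank ≤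
      ((m * n).natAbs.primeFactors.filter (fun ℓ ↦ ℓ % 4 = 1)).card := by
  have h := mordellWeilRank_twist_le m n h5 hbad hxy hx0 hx q hq5 hq11 hqΔ
  omega

end Main

/-! ## §3 The instances: the bound `ω₁` is attained at `(146, 13)` and `(13, 3)` -/

/-- `ω₁(146·13) = 2` (`13, 73 ≡ 1 (mod 4)`), and the twist rank is `2` (tree `KubertTate14613GaussianDescent`): the bound of
`mordellWeilRank_twist_le_card_split` is sharp. [cite: Fisher2001FiveSevenDescent, §2] -/
theorem card_split_146_13 : (((146 : ℤ) * 13).natAbs.primeFactors.filter (fun ℓ ↦ ℓ % 4 = 1)).card = 2 := by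
  have e : ((146 : ℤ) * 13).natAbs = 2 * 13 * 73 := by norm_num
  rw [e, Nat.primeFactors_mul (by norm_num) (by norm_num), Nat.primeFactors_mul (by norm_num) (by norm_num),
    Nat.Prime.primeFactors Nat.prime_two, Nat.Prime.primeFactors (by norm_num : Nat.Prime 13),
    Nat.Prime.primeFactors (by norm_num : Nat.Prime 73)]
  decide

/-- `ω₁(13·3) = 1` (`13 ≡ 1 (mod 4)`), and the twist rank is `1` (tree `KubertTate133GaussianDescent`). [cite: Fisher2001FiveSevenDescent, §2] -/
theorem card_split_13_3 : (((13 : ℤ) * 3).natAbs.primeFactors.filter (fun ℓ ↦ ℓ % 4 = 1)).card = 1 := by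
  have e : ((13 : ℤ) * 3).natAbs = 13 * 3 := by norm_num
  rw [e, Nat.primeFactors_mul (by norm_num) (by norm_num), Nat.Prime.primeFactors (by norm_num : Nat.Prime 13),
    Nat.Prime.primeFactors Nat.prime_three]
  decide

end KubertTateGaussianTwist

end Literature.NumberTheory.EllipticCurves

end
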